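import Summits.BirchSwinnertonDyer.BirchSwinnertonDyer.Theorems.SchneiderFreeAdditiveX3LeafIndexRegime
import Summits.BirchSwinnertonDyer.BirchSwinnertonDyer.Theorems.SchneiderFreeAdditiveX3AnticycControlAdditiveRankOneIndicesAnyTorsion
import HarnessLib

/-!
# Route `SchneiderFreeAdditiveX3` (K1 door): the index-trivial regime READ ON THE HEEGNER INDEX — `[E(K):ℤP] =
# I_K · #E(K)_tors` for the torsion-free index `I_K = [E(K)/E(K)_tors : ℤP̄]`, so the leaf at a pair follows from
# `PrintedFacts` and a datum with `ord_p I_K + ord_p #E(K)_tors ≤ ord_p ∏_ℓ c_ℓ(E) + v_p(c)` (the census currency)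

Cell `bsd-schneider-ideate`, seat `bsd-schneider-door-c5` (prover, generation 38; `--supports
stmt-BirchSwinnertonDyer-19177 --as helper`).  Sequel of `…LeafIndexRegime.lean` (this generation, F32): there the
leaf's body `MissingLowerBoundAt W p` at a pair of the door was derived from `PrintedFacts` and ONE Heegner datum with
(IDX) `ord_p [E(K):ℤP] ≤ ord_p ∏_ℓ c_ℓ(E) + v_p(Dt.c)`, the index being taken in the full group `E(K)`.  What a
Gross–Zagier computation delivers is the TORSION-FREE index `I_K = [E(K)/E(K)_tors : ℤP̄]` (`I_K² = ĥ(P_K)/ĥ(g_K)` for a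
generator `g_K` of `E(K)` modulo torsion; Gross–Zagier I.(6.3), Miller 2011 Thm. 4.1), and `E(K)` has rank ONE at a door
datum (Kolyvagin, a conjunct of `PrintedFacts`).  This file supplies the dictionary.

* §1 (pure algebra, any additive group `A` with a rank-one coordinate `c : A →+ ℤ`, `c Q = 1`, `ker c` torsion, finite
  torsion): `index_zmultiples_mk_eq_natAbs` — the index of `ℤP̄` in `A/A_tors` is `|c P|`; with door-c6's
  `index_zmultiples_eq_natAbs_mul_natCard_torsion` (`[A:ℤP] = |c P| · #A_tors`):
  `index_zmultiples_eq_index_mk_mul_natCard_torsion` — **`[A:ℤP] = [A/A_tors : ℤP̄] · #A_tors`** and its `ord_p` form.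
* §2 `padicValNat_index_zmultiples_eq_add_of_kolyvagin` — at a door datum (`K` imaginary quadratic, Heegner
  hypothesis, `P` a non-torsion Heegner point) `ord_p [E(K):ℤP] = ord_p I_K + ord_p #E(K)_tors` (rank one by Kolyvagin,
  the coordinate by the tree's Mordell–Weil `RankOne.exists_coord_of_mordellWeilRank_eq_one`).
* §3 **`missingLowerBoundAt_of_printedFacts_of_heegnerIndexLe`** — the leaf's body at `(W, p)` from `PrintedFacts` and
  a door datum with `ord_p I_K + ord_p #E(K)_tors ≤ ord_p ∏_ℓ c_ℓ(E) + v_p(Dt.c)`; `…_of_isIsogenous` for every member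
  of the class.  This is VERBATIM the certificate CERT of the census «idxcert» (kit j336347; HOME
  memos/census-door-c5-g38/): there `m₁ = √(4ρ)` is `I_K` for the parametrisation with `c = 1` (Miller's normalisation),
  `ord_p #E(K)[p^∞] = ord_p #E(ℚ)[p^∞] + ord_p #E^{(d_K)}(ℚ)[p^∞]` (odd `p`), and the Manin constant cancels
  (`I_K = c · m₁` for the datum's own parametrisation, `log_{ω_E} ∘ φ = c · log_{ω_f}`).

HONEST FRAMING.  CONDITIONAL on `PrintedFacts` (thirteen published theorems, item 19184); nothing asserted about any
curve; the existence of a datum with the inequality at a given pair is a computation (evidence), not a theorem; the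
branch cruxes r2/r3 and the class-level leaf are untouched; no item closes; BSD is proved for no curve.
References: Gross–Zagier 1986 I.(6.3) [GrossZagier1986]; Kolyvagin 1990 Thm. A / Gross 1991 Thm. 1.3 [Gross1991];
Miller 2011 Def. 1.1, Thm. 4.1 [Miller2011LMS]; Jetchev–Skinner–Wan 2017 Prop. 3.2.1, (7.1.5), §7.4.1 [JetchevSkinnerWan2017];
Silverman AEC VIII.6 [SilvermanAEC2009].
-/

set_option autoImplicit false
-- `Summit.<P>.<Sub>` repeats `BirchSwinnertonDyer` by the tree's layout convention (D-0017)
set_option linter.dupNamespace false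

noncomputable section

open scoped Classical

open Field NumberField IsDedekindDomain WeierstrassCurve
open Literature.NumberTheory.EllipticCurves Literature.NumberTheory.EllipticCurves.ModularForms
  Literature.NumberTheory.EllipticCurves.Rank1Residual Literature.NumberTheory.EllipticCurves.Rank1Residual.Typed
  Summit.BirchSwinnertonDyer.Rank1Residual Summit.BirchSwinnertonDyer.Rank1Residual.X11b
  Summit.BirchSwinnertonDyer.BirchSwinnertonDyer.Theorems.SchneiderFree
  Summit.BirchSwinnertonDyer.BirchSwinnertonDyer.Theses.SchneiderFreeAdditiveX3

namespace Summit.BirchSwinnertonDyer.BirchSwinnertonDyer.Theorems.SchneiderFreeAdditiveX3.LeafIndexRegime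

/-! ### §1 Pure algebra: the index modulo torsion -/

section Algebra

variable {A : Type*} [AddCommGroup A] {p : ℕ} [Fact p.Prime]
variable (c : A →+ ℤ) (Q : A) (hQ : c Q = 1) (hker : ∀ x : A, c x = 0 → IsOfFinAddOrder x)

include hQ hker in
/-- **`[A/A_tors : ℤP̄] = |c P|`** for a rank-one coordinate `c` (`c Q = 1`, `ker c = A_tors`): `c` factors through an
isomorphism `A/A_tors ≃ ℤ` carrying `P̄` to `c P`. [cite: JetchevSkinnerWan2017, Prop. 3.2.1 (arXiv:1512.06894 p. 10)] -/
theorem index_zmultiples_mk_eq_natAbs (P : A) :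
    (AddSubgroup.zmultiples
        (QuotientAddGroup.mk' (AddCommGroup.torsion A) P : A ⧸ AddCommGroup.torsion A)).index = (c P).natAbs := by
  -- `c` kills the torsion subgroup, hence descends to `c̄ : A/A_tors →+ ℤ`
  have hle : AddCommGroup.torsion A ≤ c.ker := by
    intro t ht
    exact RankOne.coord_eq_zero_of_isOfFinAddOrder c ((AddCommGroup.mem_torsion _).mp ht)
  set cbar : A ⧸ AddCommGroup.torsion A →+ ℤ := QuotientAddGroup.lift (AddCommGroup.torsion A) c hle with hcbar
  have hcomp : ∀ a : A, cbar (QuotientAddGroup.mk' _ a) = c a := fun a ↦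
    QuotientAddGroup.lift_mk' (AddCommGroup.torsion A) hle a
  -- `c̄` is injective: `c a = 0 ⟹ a` torsion `⟹ ā = 0`
  have hinj : Function.Injective cbar := by
    rw [injective_iff_map_eq_zero]
    intro x hx
    obtain ⟨a, rfl⟩ := QuotientAddGroup.mk'_surjective (AddCommGroup.torsion A) x
    rw [hcomp] at hx
    exact (QuotientAddGroup.eq_zero_iff a).mpr ((AddCommGroup.mem_torsion _).mpr (hker a hx))
  -- and surjective (`c` is)
  have hsurj : Function.Surjective cbar := by
    intro m
    obtain ⟨a, ha⟩ := RankOne.coord_surjective c Q hQ m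
    exact ⟨QuotientAddGroup.mk' _ a, by rw [hcomp, ha]⟩
  -- the index of `ℤP̄` is the index of its image `ℤ(c P)` in `ℤ`
  have hmap : (AddSubgroup.zmultiples (QuotientAddGroup.mk' (AddCommGroup.torsion A) P)).map cbar =
      AddSubgroup.zmultiples (c P) := by
    rw [AddMonoidHom.map_zmultiples, hcomp]
  have hidx := AddSubgroup.index_map_of_bijective (f := cbar) ⟨hinj, hsurj⟩
    (AddSubgroup.zmultiples (QuotientAddGroup.mk' (AddCommGroup.torsion A) P))
  rw [hmap, Int.index_zmultiples] at hidx
  exact hidx.symm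

include hQ hker in
/-- **`[A : ℤP] = [A/A_tors : ℤP̄] · #A_tors`** for `P` of infinite order in a group with a rank-one coordinate and
finite torsion. [cite: JetchevSkinnerWan2017, Prop. 3.2.1 and (7.1.5) (arXiv:1512.06894 pp. 10, 16)] -/
theorem index_zmultiples_eq_index_mk_mul_natCard_torsion [Finite (AddCommGroup.torsion A)] (P : A)
    (hP : ¬ IsOfFinAddOrder P) :
    (AddSubgroup.zmultiples P).index =
      (AddSubgroup.zmultiples
          (QuotientAddGroup.mk' (AddCommGroup.torsion A) P : A ⧸ AddCommGroup.torsion A)).index *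
        Nat.card (AddCommGroup.torsion A) := by
  have hcP : c P ≠ 0 := fun h ↦ hP (hker P h)
  rw [index_zmultiples_mk_eq_natAbs c Q hQ hker P, index_zmultiples_eq_natAbs_mul_natCard_torsion c Q hQ hker P hcP]

include hQ hker in
/-- **`ord_p [A : ℤP] = ord_p [A/A_tors : ℤP̄] + ord_p #A_tors`** (the `p`-adic form). [cite: JetchevSkinnerWan2017, (7.1.5)] -/
theorem padicValNat_index_zmultiples_eq_index_mk_add [Finite (AddCommGroup.torsion A)] (P : A)
    (hP : ¬ IsOfFinAddOrder P) :
    padicValNat p (AddSubgroup.zmultiples P).index =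
      padicValNat p (AddSubgroup.zmultiples
          (QuotientAddGroup.mk' (AddCommGroup.torsion A) P : A ⧸ AddCommGroup.torsion A)).index +
        padicValNat p (Nat.card (AddCommGroup.torsion A)) := by
  have hcP : c P ≠ 0 := fun h ↦ hP (hker P h)
  rw [index_zmultiples_eq_index_mk_mul_natCard_torsion c Q hQ hker P hP,
    padicValNat.mul _ Nat.card_pos.ne']
  rw [index_zmultiples_mk_eq_natAbs c Q hQ hker P]
  exact Int.natAbs_ne_zero.mpr hcP

end Algebra

/-! ### §2 At a door datum: rank one by Kolyvagin -/

/-- **`ord_p [E(K):ℤP] = ord_p I_K + ord_p #E(K)_tors` at a Heegner datum with `P` of infinite order**, `I_K` the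
torsion-free index `[E(K)/E(K)_tors : ℤP̄]`: `rank E(K) = 1` by Kolyvagin (`kolyvagin`, a conjunct of `PrintedFacts`),
a coordinate by Mordell–Weil (`RankOne.exists_coord_of_mordellWeilRank_eq_one`), then §1.
[cite: Gross1991, Thm. 1.3] [cite: JetchevSkinnerWan2017, (7.1.5) (arXiv:1512.06894 p. 16)] -/
theorem padicValNat_index_zmultiples_eq_add_of_kolyvagin
    (hKo : ∀ (N : ℕ) [NeZero N] (W : WeierstrassCurve ℚ) (K : Type) [Field K] [NumberField K],
      Literature.NumberTheory.EllipticCurves.kolyvagin N W K)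
    (W : WeierstrassCurve ℚ) [W.IsElliptic] (p : ℕ) [Fact p.Prime]
    (N : ℕ) [NeZero N] (K : Type) [Field K] [NumberField K]
    (Dt : ModularParametrizationData W N) (H : HeegnerDatum N (NumberField.discr K)) (ι : K →+* ℂ)
    (P : (W.baseChange K).toAffine.Point)
    (hK : IsImaginaryQuadratic K) (hHe : SatisfiesHeegnerHypothesis N K)
    (hP : WeierstrassCurve.Affine.Point.map ι.toRatAlgHom P = heegnerPointComplex Dt H)
    (hnt : ¬ IsOfFinAddOrder P) :
    padicValNat p (AddSubgroup.zmultiples P).index =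
      padicValNat p (AddSubgroup.zmultiples
          (QuotientAddGroup.mk' (AddCommGroup.torsion (W.baseChange K).toAffine.Point) P :
            (W.baseChange K).toAffine.Point ⧸ AddCommGroup.torsion (W.baseChange K).toAffine.Point)).index +
        padicValNat p (Nat.card (AddCommGroup.torsion (W.baseChange K).toAffine.Point)) := by
  have hrk : (W.baseChange K).mordellWeilRank = 1 := (hKo N W K hK hHe ⟨Dt, H, ι, hP⟩ hnt).1
  obtain ⟨c, Q, hQ, hker⟩ := RankOne.exists_coord_of_mordellWeilRank_eq_one (W.baseChange K) hrk
  haveI : Finite (AddCommGroup.torsion (W.baseChange K).toAffine.Point) := (W.baseChange K).finite_torsion_point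
  exact padicValNat_index_zmultiples_eq_index_mk_add c Q hQ hker P hnt

/-! ### §3 The leaf at a pair on the Heegner index -/

/-- **The leaf's body at a pair of the door from `PrintedFacts` and ONE datum whose HEEGNER INDEX lies in the
Tamagawa + Manin slack** — the census currency: `ord_p I_K + ord_p #E(K)_tors ≤ ord_p ∏_ℓ c_ℓ(E) + v_p(Dt.c)` with
`I_K = [E(K)/E(K)_tors : ℤP̄]`.  NO main conjecture, NO control, NO duality, NO Kriz–Li theorem, NO preprint.
CONDITIONAL on `PrintedFacts`. [cite: GrossZagier1986, Thm. I.(6.3)] [cite: Miller2011LMS, Def. 1.1 and Thm. 4.1] -/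
theorem missingLowerBoundAt_of_printedFacts_of_heegnerIndexLe (hF : PrintedFacts)
    (W : WeierstrassCurve ℚ) [W.IsElliptic] [W.IsGloballyMinimal] (p : ℕ) [Fact p.Prime]
    (hr : W.analyticRank = 1) (hp2 : p ≠ 2) (hX : ClassX3 W p) (hS : Additive.SubSemistableTwist W p)
    (N : ℕ) [NeZero N] (K : Type) [Field K] [NumberField K]
    (Dt : ModularParametrizationData W N) (H : HeegnerDatum N (NumberField.discr K)) (ι : K →+* ℂ)
    (P : (W.baseChange K).toAffine.Point)
    (hN : W.conductorNorm ℤ = N) (hK : IsImaginaryQuadratic K) (hodd : Odd (NumberField.discr K))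
    (hunit : ¬ p ∣ Units.torsionOrder K) (hHe : SatisfiesHeegnerHypothesis N K)
    (hLt : (W.quadraticTwist (NumberField.discr K : ℚ)).entireLFunction 1 ≠ 0)
    (hP : WeierstrassCurve.Affine.Point.map ι.toRatAlgHom P = heegnerPointComplex Dt H)
    (hnt : ¬ IsOfFinAddOrder P)
    (hIK : padicValNat p (AddSubgroup.zmultiples
          (QuotientAddGroup.mk' (AddCommGroup.torsion (W.baseChange K).toAffine.Point) P :
            (W.baseChange K).toAffine.Point ⧸ AddCommGroup.torsion (W.baseChange K).toAffine.Point)).index +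
        padicValNat p (Nat.card (AddCommGroup.torsion (W.baseChange K).toAffine.Point)) ≤
      padicValNat p W.tamagawaProduct + padicValNat p Dt.c.natAbs) :
    MissingLowerBoundAt W p := by
  refine missingLowerBoundAt_of_printedFacts_of_indexLe hF W p hr hp2 hX hS N K Dt H ι P hN hK hodd hunit hHe hLt hP
    hnt ?_
  rw [padicValNat_index_zmultiples_eq_add_of_kolyvagin hF.2.1 W p N K Dt H ι P hK hHe hP hnt]
  exact hIK

/-- **The same for every member of the isogeny class** (one Heegner-index certificate per class; Cassels).
CONDITIONAL on `PrintedFacts`. [cite: MilneADT2006, Thm. I.7.3] [cite: Miller2011LMS, §1 and Def. 1.1] -/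
theorem missingLowerBoundAt_of_printedFacts_of_heegnerIndexLe_of_isIsogenous (hF : PrintedFacts)
    (W : WeierstrassCurve ℚ) [W.IsElliptic] [W.IsGloballyMinimal] (p : ℕ) [Fact p.Prime]
    (hr : W.analyticRank = 1) (hp2 : p ≠ 2) (hX : ClassX3 W p) (hS : Additive.SubSemistableTwist W p)
    (N : ℕ) [NeZero N] (K : Type) [Field K] [NumberField K]
    (Dt : ModularParametrizationData W N) (H : HeegnerDatum N (NumberField.discr K)) (ι : K →+* ℂ)
    (P : (W.baseChange K).toAffine.Point)
    (hN : W.conductorNorm ℤ = N) (hK : IsImaginaryQuadratic K) (hodd : Odd (NumberField.discr K))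
    (hunit : ¬ p ∣ Units.torsionOrder K) (hHe : SatisfiesHeegnerHypothesis N K)
    (hLt : (W.quadraticTwist (NumberField.discr K : ℚ)).entireLFunction 1 ≠ 0)
    (hP : WeierstrassCurve.Affine.Point.map ι.toRatAlgHom P = heegnerPointComplex Dt H)
    (hnt : ¬ IsOfFinAddOrder P)
    (hIK : padicValNat p (AddSubgroup.zmultiples
          (QuotientAddGroup.mk' (AddCommGroup.torsion (W.baseChange K).toAffine.Point) P :
            (W.baseChange K).toAffine.Point ⧸ AddCommGroup.torsion (W.baseChange K).toAffine.Point)).index +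
        padicValNat p (Nat.card (AddCommGroup.torsion (W.baseChange K).toAffine.Point)) ≤
      padicValNat p W.tamagawaProduct + padicValNat p Dt.c.natAbs)
    (W' : WeierstrassCurve ℚ) [W'.IsElliptic] [W'.IsGloballyMinimal] (hiso : IsIsogenous W W') :
    MissingLowerBoundAt W' p :=
  Additive.TwistComparison.missingLowerBoundAt_of_isIsogenous W W' p hF.2.2.2.2.2.1 hF.2.2.1 hF.2.2.2.1 hiso
    (by rw [hr])
    (missingLowerBoundAt_of_printedFacts_of_heegnerIndexLe hF W p hr hp2 hX hS N K Dt H ι P hN hK hodd hunit hHe hLt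
      hP hnt hIK)

end Summit.BirchSwinnertonDyer.BirchSwinnertonDyer.Theorems.SchneiderFreeAdditiveX3.LeafIndexRegime

end
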